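import Summits.BirchSwinnertonDyer.Rank1Residual.X10.MuZeroRoad
import Summits.BirchSwinnertonDyer.BirchSwinnertonDyer.Theorems.Rank1ResidualX11RankOneReduction
import Summits.BirchSwinnertonDyer.Rank1Residual.X11b.CertificateCheckBridge
import Literature.NumberTheory.EllipticCurves.Rank1Residual.PeriodUnitProofs
import HarnessLib

/-!
# Class X10 ∩ {r = 0} at `p = 3` (X10a′ AND X10b = N2), the `μ`-ZERO ROAD, part 2 of 2: Greenberg's
# `μ = 0` at `(E,3)` ⟹ `ord₃ #Ш ≤ ord₃ #Ш_an` and `MazurMainConjecture W 3 ↔ BSDp W 3` with NO image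
# hypothesis; per pair, X_A3 ⟺ Greenberg's Conj. 1.11 where `BSD(E,3)` is certificate-closed
# (cell `b2b-bsdres`, unit `b2b-bsdres-x10` = N2 class lead, GEN 34; TOOL — theorems only, no definition,
# no named fact, nothing booked)

HONEST FRAMING (run/shared/lean/b2b/bsd-rank1-residual/, verbatim in every file): the goal of the
cell is to DELETE the COMBINATION-SHAPED residual classes of the Birch–Swinnerton-Dyer formula for
ALL analytic-rank `≤ 1` elliptic curves over `ℚ` — "full BSD formula for every rank `≤ 1` curve in
class `C`" assembled STRICTLY from published theorems — so that the rank-`≤ 1` remainder becomes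
exactly the CONSTRUCTION-SHAPED classes, which are TYPED (missing-input `Prop`s), NOT attempted.
This is not "finishing BSD". Class X10b (N2) keeps its label CONSTRUCTION-SHAPED / NEEDS X_A3
(RESIDUAL-MAP §I N2); nothing is booked by this file; no census number moves.

## What (x10 GEN 34, X10-AUDIT §40)

Part 1 (`X10/MuZeroRoad.lean`) proved at any odd good ordinary prime with `E[p]` irreducible and
`L(E,1) ≠ 0`: Greenberg's `μ = 0` at the pair + Kato Thm. 17.4 (2) ⟹ the integral divisibility, hence the
Euler-system half and (main conjecture ⟺ typed lower bound ⟺ `BSD(E,p)`). THIS file: the instances on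
class X10 (`ClassX10 W 3`: `3` good ordinary, `E[3]` irreducible — NO surjectivity; so X10a′ and X10b
alike), analytic rank `0`, with Greenberg's Thm. 4.1 taken from Schneider 1985 / BMS odd (`hS`) +
Mazur–Stein–Tate σ odd (`hMT`) as in `MainConjectureBinderFree`, and the inline period unit derived from
the named fact `h3` (`realPeriodRat_eq_unit_mul_plusPeriod_three`, via `PeriodUnitProofs`):

* `padicValRat_periodRatio_eq_zero_three` — bookkeeping `h3 ⟹ ord₃ ϖ = 0`;
* `missingUpperBoundAt_three_of_greenbergMu` — **`μ = 0` at `(E,3)` ⟹ `ord₃ #Ш ≤ ord₃ #Ш_an`** (on X10b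
  this half has NO printed source: Wuthrich Prop. 21's constant is divisible by `3` there, Kato (3) needs
  surjectivity);
* `mazurMainConjecture_iff_bsdp_three_of_greenbergMu`, `mazurMainConjecture_iff_missingLowerBoundAt_three_of_greenbergMu`,
  `mazurMainConjecture_three_of_greenbergMu_of_bsdp` — **under `μ = 0`: X_A3 ⟺ `BSDp W 3` ⟺ the lower
  half**; the last is the `μ`-ZERO ROAD to X_A3 AT THE PAIR for every rank-`0` N2 cell (`BSD(E,3)` is
  booked per pair by the lane's certificates, R146.1 / R171.3);
* `greenbergMu_of_mazurMainConjecture_three_of_cert`, `mazurMainConjecture_iff_greenbergMu_three_of_bsdp_of_cert`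
  — the converse with the `μ^an = 0` certificate, so that **at a certificate-closed rank-`0` N2 pair,
  X_A3 at the pair ⟺ Greenberg's Conj. 1.11 at the pair** — a statement about `ρ̄_{E,3}` up to the
  good-ordinary congruence class (Greenberg–Vatsal Thm. (1.4));
* `MuZeroRoad.missingUpperBoundAt_three_of_ainvs_of_greenbergMu`,
  `MuZeroRoad.mazurMainConjecture_three_of_ainvs_of_greenbergMu_of_bsdp` — the same two conclusions read
  off a LITERAL integer model `[a₁,…,a₆]` (`3 ∤ Δ`, the schema count `countPoints [a₁,…,a₆] 3 = n₃ = #Ẽ(𝔽₃)`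
  — `X11b.natCard_point_eq_countPoints` — with `3 ∤ 4 − n₃`, a Frobenius witness `ℓ` with
  `X² − (ℓ+1−n)X + ℓ` root-free mod `3`; all `decide`d per cell), the shape consumed BY NAME by the per-cell RECORDS
  `X10/MuZeroRoadRecords*.lean` (the rank-`0` N2 cells WITHOUT a trivial road: anomalous, parity-odd or
  Ш-cells of `class-closure/N2/TRIVIAL-ROADS-x10g27.tsv`).

References: K. Kato, Astérisque 295 (2004) Thm. 17.4 (2) [Kato2004Asterisque]; R. Greenberg, LNM 1716
(1999) Conj. 1.11, Thm. 4.1, §5 [GreenbergLNM1716]; R. Greenberg, V. Vatsal, Invent. Math. 142 (2000)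
p. 2 (1)–(2), §3 Remark (3.4), Thm. (1.4) [GreenbergVatsal2000]; B. Mazur, Invent. Math. 44 (1978) Cor. 4.1
[Mazur1978]; Balakrishnan–Müller–Stein, Math. Comp. (2016) Thm. 1.7 [BalakrishnanMullerStein2015];
C. Wuthrich, Doc. Math. 19 (2014) Prop. 21 [Wuthrich2014]; R. L. Miller, LMS J. Comput. Math. 14 (2011)
Def. 1.1 [Miller2011LMS]; cell files X10-AUDIT.md §40, `X10/MainConjectureBinderFree.lean`, `X10/MuZeroRoad.lean`.
-/

set_option autoImplicit false

noncomputable section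

open scoped Classical MatrixGroups ModularForm

open CongruenceSubgroup WeierstrassCurve Literature.NumberTheory.EllipticCurves
  Literature.NumberTheory.EllipticCurves.ModularForms Literature.NumberTheory.EllipticCurves.Rank1Residual
  Literature.NumberTheory.EllipticCurves.Rank1Residual.Typed
  Literature.NumberTheory.EllipticCurves.Wuthrich2014
  Literature.NumberTheory.EllipticCurves.Rank1Residual.X11RankOneCertificates
  Summit.BirchSwinnertonDyer.BirchSwinnertonDyer.Rank1Residual.IntModel
  Summit.BirchSwinnertonDyer.BirchSwinnertonDyer.Rank1Residual.X11RankOne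
  Summit.BirchSwinnertonDyer.BirchSwinnertonDyer.Theorems.Rank1ResidualX1Defs

namespace Summit.BirchSwinnertonDyer.Rank1Residual.X10

/-! ### §3. Class X10 ∩ {r = 0} at `p = 3` — X10a′ AND X10b (N2): no image hypothesis -/

section X10Three

variable (W : WeierstrassCurve ℚ) [W.IsElliptic] [W.IsGloballyMinimal]

/-- The inline period-unit hypothesis at `p = 3` from the named fact `h3`
(`realPeriodRat_eq_unit_mul_plusPeriod_three`; Greenberg–Vatsal 2000 §3 Remark (3.4) with Mazur 1978
Cor. 4.1), for a globally minimal curve good at `3` with `E[3]` irreducible. Bookkeeping.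
[cite: GreenbergVatsal2000, §3 Remark (3.4)] [cite: Mazur1978, Cor. 4.1] -/
theorem padicValRat_periodRatio_eq_zero_three (h3 : realPeriodRat_eq_unit_mul_plusPeriod_three)
    (hgood : W.HasGoodReductionAtPrime 3) (hirr : W.HasIrreducibleModPGaloisRep 3)
    {N : ℕ} [NeZero N] (f : CuspForm (Gamma0 N) 2) (hf : IsNewformOf W f) (ϖ : ℚ)
    (hϖeq : (ϖ : ℝ) * W.realPeriodRat = plusPeriod f) : padicValRat 3 ϖ = 0 := by
  haveI : Fact (Nat.Prime 3) := ⟨by norm_num⟩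
  obtain ⟨u, hu, hΩ⟩ := h3 W hgood hirr f hf
  exact padicValRat_periodRatio_eq_zero_of_eq_unit_mul W 3 f hu hΩ ϖ hϖeq

/-- **N2 ∩ {r = 0} (and X10a′ ∩ {r = 0}): Greenberg's `μ = 0` at `(E,3)` ⟹ the Euler-system half
`ord₃ #Ш(E/ℚ) ≤ ord₃ #Ш(E/ℚ)_an`** (`Typed.MissingUpperBoundAt W 3`) on class X10 (`3` good ordinary,
`E[3]` irreducible — NO image hypothesis), analytic rank `0`. PUBLISHED binders: Kato Thm. 17.4 (2)
(`hK`), Schneider 1985 / BMS odd (`hS`) + Mazur–Stein–Tate σ odd (`hMT`) for Greenberg's Thm. 4.1,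
modularity (`hmod`), GZK (`hGZK`), the period unit at `3` (`h3`); HYPOTHESIS `hμ` = Greenberg's Conj.
1.11 at the pair. On X10b this half has NO printed source (Wuthrich Prop. 21's constant is divisible by
`3` there; Kato (3) needs surjectivity). [cite: Kato2004Asterisque, Thm. 17.4 (2) (p. 273)]
[cite: GreenbergLNM1716, §1 Conj. 1.11 and Thm. 4.1] [cite: Wuthrich2014, Prop. 21 (p. 400)]
[cite: BalakrishnanMullerStein2015, Thm. 1.7] -/
theorem missingUpperBoundAt_three_of_greenbergMu (hS : Schneider1985_order_charGenerator_odd)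
    (hMT : mazur_tate_sigma_exists_odd)
    (hmod : nonempty_modularParametrizationData)
    (hGZK : rank_eq_analyticRank_of_analyticRank_le_one)
    (hK : ∀ (κ : ZpExtension ℚ 3) (γ : Field.absoluteGaloisGroup ℚ) [NeZero (W.conductorNorm ℤ)]
      (f : CuspForm (Gamma0 (W.conductorNorm ℤ)) 2), kato_divisibility W 3 (κ := κ) (γ := γ) (f := f))
    (h3 : realPeriodRat_eq_unit_mul_plusPeriod_three)
    (hX : ClassX10 W 3) (hr0 : W.analyticRank = 0)
    (hμ : ∀ (κ : ZpExtension ℚ 3) (γ : Field.absoluteGaloisGroup ℚ),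
        κ.IsCyclotomic → κ.IsTopGenerator γ → IsCyclotomicVariable 3 γ →
      ∀ (D : W.SelmerDualData κ γ), D.mu = 0) :
    Typed.MissingUpperBoundAt W 3 := by
  haveI : NeZero (W.conductorNorm ℤ) := ⟨(W.conductorNorm_pos_holds).ne'⟩
  obtain ⟨Dm⟩ := hmod W
  have hL : W.entireLFunction 1 ≠ 0 :=
    (W.analyticRank_eq_zero_iff_holds Dm.isNewformOf.hasEntireLFunction).mp hr0
  exact missingUpperBoundAt_of_kato_of_greenbergMu W 3
    (greenberg_charValue_rankZero_of_Schneider1985_odd hS hMT) hmod hGZK hK (by decide) hX.2.1.1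
    hX.2.1.2 hX.2.2.1 hL
    (fun f hf ϖ hϖeq ↦ padicValRat_periodRatio_eq_zero_three W h3 hX.2.1.1 hX.2.2.1 f hf ϖ hϖeq) hμ

/-- **N2 ∩ {r = 0} (and X10a′ ∩ {r = 0}): under Greenberg's `μ = 0` at `(E,3)`,
`MazurMainConjecture W 3 ↔ BSDp W 3`** on class X10, analytic rank `0` — NO image hypothesis
(compare `mazurMainConjecture_iff_bsdp_three_of_towerSurj`: surj(3) and Kato (3)). Binders as in
`missingUpperBoundAt_three_of_greenbergMu`. [cite: Kato2004Asterisque, Thm. 17.4 (2) (p. 273)]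
[cite: GreenbergLNM1716, §1 Conj. 1.11, Thm. 4.1 and §5 (closing examples)]
[cite: BalakrishnanMullerStein2015, Thm. 1.7] [cite: Miller2011LMS, Def. 1.1 (arXiv:1010.2431 p. 3)] -/
theorem mazurMainConjecture_iff_bsdp_three_of_greenbergMu
    (hS : Schneider1985_order_charGenerator_odd) (hMT : mazur_tate_sigma_exists_odd)
    (hmod : nonempty_modularParametrizationData)
    (hGZK : rank_eq_analyticRank_of_analyticRank_le_one)
    (hK : ∀ (κ : ZpExtension ℚ 3) (γ : Field.absoluteGaloisGroup ℚ) [NeZero (W.conductorNorm ℤ)]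
      (f : CuspForm (Gamma0 (W.conductorNorm ℤ)) 2), kato_divisibility W 3 (κ := κ) (γ := γ) (f := f))
    (h3 : realPeriodRat_eq_unit_mul_plusPeriod_three)
    (hX : ClassX10 W 3) (hr0 : W.analyticRank = 0)
    (hμ : ∀ (κ : ZpExtension ℚ 3) (γ : Field.absoluteGaloisGroup ℚ),
        κ.IsCyclotomic → κ.IsTopGenerator γ → IsCyclotomicVariable 3 γ →
      ∀ (D : W.SelmerDualData κ γ), D.mu = 0) :
    MazurMainConjecture W 3 ↔ BSDp W 3 := by
  haveI : NeZero (W.conductorNorm ℤ) := ⟨(W.conductorNorm_pos_holds).ne'⟩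
  obtain ⟨Dm⟩ := hmod W
  have hL : W.entireLFunction 1 ≠ 0 :=
    (W.analyticRank_eq_zero_iff_holds Dm.isNewformOf.hasEntireLFunction).mp hr0
  exact mainConjecture_iff_bsdp_of_kato_of_greenbergMu W 3
    (greenberg_charValue_rankZero_of_Schneider1985_odd hS hMT) hmod hGZK hK (by decide) hX.2.1.1
    hX.2.1.2 hX.2.2.1 hL
    (fun f hf ϖ hϖeq ↦ padicValRat_periodRatio_eq_zero_three W h3 hX.2.1.1 hX.2.2.1 f hf ϖ hϖeq) hμ

/-- **N2 ∩ {r = 0}: under Greenberg's `μ = 0` at `(E,3)`,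
`MazurMainConjecture W 3 ↔ Typed.MissingLowerBoundAt W 3`** on class X10, analytic rank `0`, no image
hypothesis — i.e. GIVEN `μ = 0` the missing piece of the rank-`0` branch of N2 is EXACTLY the
Skinner–Urban direction (the lower bound), as on X10a′. Binders as above.
[cite: Kato2004Asterisque, Thm. 17.4 (2) (p. 273)] [cite: GreenbergLNM1716, §1 Conj. 1.11, Thm. 4.1 and §5 (closing examples)]
[cite: SkinnerUrban2014, Thm. 3.6.9 (p. 45): the (ram) hypothesis] -/
theorem mazurMainConjecture_iff_missingLowerBoundAt_three_of_greenbergMu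
    (hS : Schneider1985_order_charGenerator_odd) (hMT : mazur_tate_sigma_exists_odd)
    (hmod : nonempty_modularParametrizationData)
    (hGZK : rank_eq_analyticRank_of_analyticRank_le_one)
    (hK : ∀ (κ : ZpExtension ℚ 3) (γ : Field.absoluteGaloisGroup ℚ) [NeZero (W.conductorNorm ℤ)]
      (f : CuspForm (Gamma0 (W.conductorNorm ℤ)) 2), kato_divisibility W 3 (κ := κ) (γ := γ) (f := f))
    (h3 : realPeriodRat_eq_unit_mul_plusPeriod_three)
    (hX : ClassX10 W 3) (hr0 : W.analyticRank = 0)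
    (hμ : ∀ (κ : ZpExtension ℚ 3) (γ : Field.absoluteGaloisGroup ℚ),
        κ.IsCyclotomic → κ.IsTopGenerator γ → IsCyclotomicVariable 3 γ →
      ∀ (D : W.SelmerDualData κ γ), D.mu = 0) :
    MazurMainConjecture W 3 ↔ Typed.MissingLowerBoundAt W 3 := by
  haveI : NeZero (W.conductorNorm ℤ) := ⟨(W.conductorNorm_pos_holds).ne'⟩
  obtain ⟨Dm⟩ := hmod W
  have hL : W.entireLFunction 1 ≠ 0 :=
    (W.analyticRank_eq_zero_iff_holds Dm.isNewformOf.hasEntireLFunction).mp hr0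
  exact mainConjecture_iff_missingLowerBoundAt_of_kato_of_greenbergMu W 3
    (greenberg_charValue_rankZero_of_Schneider1985_odd hS hMT) hmod hGZK hK (by decide) hX.2.1.1
    hX.2.1.2 hX.2.2.1 hL
    (fun f hf ϖ hϖeq ↦ padicValRat_periodRatio_eq_zero_three W h3 hX.2.1.1 hX.2.2.1 f hf ϖ hϖeq) hμ

/-- **N2 ∩ {r = 0}: Greenberg's `μ = 0` at `(E,3)` + `BSDp W 3` ⟹ X_A3 at the pair,
`MazurMainConjecture W 3`** (class X10, analytic rank `0`, no image hypothesis). This is the `μ`-ZERO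
ROAD to X_A3 AT THE PAIR for every rank-`0` N2 cell: `BSD(E,3)` is booked per pair by the lane's
certificates (R146.1 / R171.3), so the per-pair residue of X_A3 is Greenberg's Conj. 1.11 at the pair and
nothing else. Binders as above. [cite: Kato2004Asterisque, Thm. 17.4 (2) (p. 273)]
[cite: GreenbergLNM1716, §1 Conj. 1.11 and §5 (closing examples)] [cite: Miller2011LMS, Def. 1.1 (arXiv:1010.2431 p. 3)] -/
theorem mazurMainConjecture_three_of_greenbergMu_of_bsdp
    (hS : Schneider1985_order_charGenerator_odd) (hMT : mazur_tate_sigma_exists_odd)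
    (hmod : nonempty_modularParametrizationData)
    (hGZK : rank_eq_analyticRank_of_analyticRank_le_one)
    (hK : ∀ (κ : ZpExtension ℚ 3) (γ : Field.absoluteGaloisGroup ℚ) [NeZero (W.conductorNorm ℤ)]
      (f : CuspForm (Gamma0 (W.conductorNorm ℤ)) 2), kato_divisibility W 3 (κ := κ) (γ := γ) (f := f))
    (h3 : realPeriodRat_eq_unit_mul_plusPeriod_three)
    (hX : ClassX10 W 3) (hr0 : W.analyticRank = 0)
    (hμ : ∀ (κ : ZpExtension ℚ 3) (γ : Field.absoluteGaloisGroup ℚ),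
        κ.IsCyclotomic → κ.IsTopGenerator γ → IsCyclotomicVariable 3 γ →
      ∀ (D : W.SelmerDualData κ γ), D.mu = 0)
    (hbsd : BSDp W 3) : MazurMainConjecture W 3 :=
  (mazurMainConjecture_iff_bsdp_three_of_greenbergMu W hS hMT hmod hGZK hK h3 hX hr0 hμ).mpr hbsd

/-- **The converse at `p = 3`: X_A3 at the pair + the `μ^an = 0` certificate ⟹ Greenberg's `μ = 0` at
`(E,3)`** (every cyclotomic datum), for any globally minimal elliptic `W` — no class hypothesis, no named
fact: `MazurMainConjecture W 3` at the newform of level `N_E` (`hmod` supplies one) with its period ratio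
`ϖ`, and `hcert` (one unit coefficient of `ϖ · L₃(f, α)` for every such `f`, `ϖ`).
[cite: GreenbergVatsal2000, p. 2 (1)–(2)] [cite: GreenbergLNM1716, §1 Conj. 1.11] -/
theorem greenbergMu_of_mazurMainConjecture_three_of_cert
    (hmod : nonempty_modularParametrizationData)
    (hcert : ∀ [NeZero (W.conductorNorm ℤ)] (f : CuspForm (Gamma0 (W.conductorNorm ℤ)) 2),
        IsNewformOf W f → ∀ (ϖ : ℚ), (ϖ : ℝ) * W.realPeriodRat = plusPeriod f →
      ∃ n : ℕ, ‖PowerSeries.coeff n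
        (PowerSeries.C (ϖ : ℚ_[3]) * padicLFunction f (unitRoot W 3 : ℚ_[3]))‖ = 1)
    (hMC : MazurMainConjecture W 3) :
    ∀ (κ : ZpExtension ℚ 3) (γ : Field.absoluteGaloisGroup ℚ),
        κ.IsCyclotomic → κ.IsTopGenerator γ → IsCyclotomicVariable 3 γ →
      ∀ (D : W.SelmerDualData κ γ), D.mu = 0 := by
  intro κ γ hκ hγ hγ' D
  haveI : Fact (Nat.Prime 3) := ⟨by norm_num⟩
  haveI : NeZero (W.conductorNorm ℤ) := ⟨(W.conductorNorm_pos_holds).ne'⟩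
  obtain ⟨Dm⟩ := hmod W
  have hf : IsNewformOf W Dm.f := Dm.isNewformOf
  obtain ⟨ϖ, -, hϖeq, -⟩ := Dm.exists_rat_mul_realPeriodRat_eq_plusPeriod
  exact mu_eq_zero_of_mainConjectureAt_of_cert W 3 hγ D (hMC κ γ hκ hγ hγ' Dm.f hf ϖ hϖeq D)
    (hcert Dm.f hf ϖ hϖeq)

/-- **N2 ∩ {r = 0}, per pair: at a rank-`0` class-X10 pair where `BSD(E,3)` holds (`hbsd`; booked by the
lane's certificates) and one coefficient of `ϖ · L₃(f, α)` is a `3`-adic unit (`hcert`, the `μ^an = 0`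
certificate), X_A3 at the pair ⟺ Greenberg's Conj. 1.11 at the pair:
`MazurMainConjecture W 3 ↔ (μ(X(E/ℚ_∞)) = 0 for every cyclotomic datum)`.** PUBLISHED binders `hK`
(Kato 17.4 (2)), `hS` + `hMT` (Greenberg 4.1), `hmod`, `hGZK`, `h3`. No image hypothesis; nothing booked;
the class label does not move. [cite: Kato2004Asterisque, Thm. 17.4 (2) (p. 273)]
[cite: GreenbergLNM1716, §1 Conj. 1.11, Thm. 4.1 and §5] [cite: GreenbergVatsal2000, p. 2 (1)–(2)] -/
theorem mazurMainConjecture_iff_greenbergMu_three_of_bsdp_of_cert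
    (hS : Schneider1985_order_charGenerator_odd) (hMT : mazur_tate_sigma_exists_odd)
    (hmod : nonempty_modularParametrizationData)
    (hGZK : rank_eq_analyticRank_of_analyticRank_le_one)
    (hK : ∀ (κ : ZpExtension ℚ 3) (γ : Field.absoluteGaloisGroup ℚ) [NeZero (W.conductorNorm ℤ)]
      (f : CuspForm (Gamma0 (W.conductorNorm ℤ)) 2), kato_divisibility W 3 (κ := κ) (γ := γ) (f := f))
    (h3 : realPeriodRat_eq_unit_mul_plusPeriod_three)
    (hX : ClassX10 W 3) (hr0 : W.analyticRank = 0) (hbsd : BSDp W 3)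
    (hcert : ∀ [NeZero (W.conductorNorm ℤ)] (f : CuspForm (Gamma0 (W.conductorNorm ℤ)) 2),
        IsNewformOf W f → ∀ (ϖ : ℚ), (ϖ : ℝ) * W.realPeriodRat = plusPeriod f →
      ∃ n : ℕ, ‖PowerSeries.coeff n
        (PowerSeries.C (ϖ : ℚ_[3]) * padicLFunction f (unitRoot W 3 : ℚ_[3]))‖ = 1) :
    MazurMainConjecture W 3 ↔
      ∀ (κ : ZpExtension ℚ 3) (γ : Field.absoluteGaloisGroup ℚ),
          κ.IsCyclotomic → κ.IsTopGenerator γ → IsCyclotomicVariable 3 γ →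
        ∀ (D : W.SelmerDualData κ γ), D.mu = 0 :=
  ⟨greenbergMu_of_mazurMainConjecture_three_of_cert W hmod hcert,
    fun hμ ↦ mazurMainConjecture_three_of_greenbergMu_of_bsdp W hS hMT hmod hGZK hK h3 hX hr0 hμ hbsd⟩

end X10Three

/-! ### §4. The same, read off a literal integer model (the shape of the per-cell RECORDS) -/

namespace MuZeroRoad

/-- Good reduction at `3`, ordinarity and irreducibility of `E[3]`, read off a literal integer model by
kernel-decidable data: `3 ∤ Δ`; the schema count `countPoints [a₁,…,a₆] 3 = n₃` (`= #Ẽ(𝔽₃)`,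
`X11b.natCard_point_eq_countPoints`) with `3 ∤ 4 − n₃`; a Frobenius witness `ℓ ≠ 2, 3`, `ℓ ∤ Δ`,
`countPoints [a₁,…,a₆] ℓ = n` with `X² − (ℓ+1−n)X + ℓ` root-free mod `3` (Mazur 1978 Prop. 6.3 (1),
`hasIrreducibleModPGaloisRep_of_intModel_of_noroot`). Bookkeeping shared by the two record shapes.
[cite: Mazur1978, §6 Prop. 6.3 (1) (p. 153)] [cite: IrelandRosen1990, Prop. 5.1.2 and §8.1] -/
theorem goodOrdIrr_three_of_ainvs_of_countPoints (a1 a2 a3 a4 a6 : ℤ) {W : WeierstrassCurve ℚ}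
    [W.IsElliptic] [W.IsGloballyMinimal] (hW : integralModelInt W = ⟨a1, a2, a3, a4, a6⟩)
    [Fact (Nat.Prime 3)] (ℓ n n3 : ℕ) [Fact ℓ.Prime]
    (h3Δ : ¬ (3 : ℤ) ∣ discOf [a1, a2, a3, a4, a6])
    (hc3 : countPoints [a1, a2, a3, a4, a6] 3 = n3) (hord3 : ¬ (3 : ℤ) ∣ (3 : ℤ) + 1 - n3)
    (hℓ2 : ℓ ≠ 2) (hℓ3 : ℓ ≠ 3) (hℓΔ : ¬ (ℓ : ℤ) ∣ discOf [a1, a2, a3, a4, a6])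
    (hc : countPoints [a1, a2, a3, a4, a6] ℓ = n)
    (hnoroot : ∀ t : ℕ, t < 3 → ¬ (3 : ℤ) ∣ (t : ℤ) ^ 2 - ((ℓ : ℤ) + 1 - n) * t + ℓ) :
    W.HasGoodReductionAtPrime 3 ∧ ¬ ((3 : ℕ) : ℤ) ∣ W.frobeniusTrace 3 ∧
      W.HasIrreducibleModPGaloisRep 3 := by
  have hΔ : (⟨a1, a2, a3, a4, a6⟩ : WeierstrassCurve ℤ).Δ = discOf [a1, a2, a3, a4, a6] :=
    intCurve_Δ a1 a2 a3 a4 a6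
  have hcard3 : Nat.card (((⟨a1, a2, a3, a4, a6⟩ : WeierstrassCurve ℤ).map
      (Int.castRingHom (ZMod 3))).toAffine.Point) = n3 := by
    have h := X11b.natCard_point_eq_countPoints a1 a2 a3 a4 a6 3 (by decide) (by rw [hΔ]; exact h3Δ)
    rw [hc3] at h
    exact_mod_cast h
  have hcard : Nat.card (((⟨a1, a2, a3, a4, a6⟩ : WeierstrassCurve ℤ).map
      (Int.castRingHom (ZMod ℓ))).toAffine.Point) = n := by
    have h := X11b.natCard_point_eq_countPoints a1 a2 a3 a4 a6 ℓ hℓ2 (by rw [hΔ]; exact hℓΔ)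
    rw [hc] at h
    exact_mod_cast h
  have hgood : W.HasGoodReductionAtPrime 3 :=
    hasGoodReductionAtPrime_of_not_dvd W 3 (by rw [minimalDiscriminantInt_eq hW, hΔ]; exact h3Δ)
  have hord : ¬ ((3 : ℕ) : ℤ) ∣ W.frobeniusTrace 3 := by
    rw [frobeniusTrace_eq hW hcard3]; exact hord3
  have hirr : W.HasIrreducibleModPGaloisRep 3 := by
    refine hasIrreducibleModPGaloisRep_of_intModel_of_noroot hW 3 ℓ hℓ3 (by rw [hΔ]; exact hℓΔ) hcard
      (forall_zmod_of_forall_lt fun t ht h0 ↦ hnoroot t ht ?_)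
    change ((3 : ℕ) : ℤ) ∣ _
    rw [← ZMod.intCast_zmod_eq_zero_iff_dvd]
    push_cast at h0 ⊢
    linear_combination h0
  exact ⟨hgood, hord, hirr⟩

/-- **Greenberg's `μ = 0` at `(E,3)` ⟹ `ord₃ #Ш(E/ℚ) ≤ ord₃ #Ш(E/ℚ)_an`, for a cell given by a literal
integer model.** Target `W` (integral model `[a₁,…,a₆]`): `3 ∤ Δ` (good at `3`), `countPoints [a₁,…,a₆] 3 = n₃`
(`= #W̃(𝔽₃)`) with `3 ∤ 4 − n₃` (ordinary; anomalous ALLOWED), a good prime `ℓ ≠ 2, 3` with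
`countPoints [a₁,…,a₆] ℓ = n` and `X² − (ℓ+1−n)X + ℓ` root-free mod `3` (`E[3]` irreducible); census
binder `hL : L(E,1) ≠ 0`; PUBLISHED `hkato` (Kato 17.4, clause (2) used), `hS` + `hMT` (Greenberg 4.1 at
odd `p`), `hmod`, `hGZK`, `h3`; HYPOTHESIS `hμ` (Greenberg Conj. 1.11 at the pair). One-line instance of
`missingUpperBoundAt_of_kato_of_greenbergMu` (part 1). Per pair; no class statement; nothing booked.
[cite: Kato2004Asterisque, Thm. 17.4 (2) (p. 273)] [cite: GreenbergLNM1716, §1 Conj. 1.11 and Thm. 4.1]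
[cite: Mazur1978, §6 Prop. 6.3 (1) (p. 153)] -/
theorem missingUpperBoundAt_three_of_ainvs_of_greenbergMu
    (hkato : ∀ (W : WeierstrassCurve ℚ) [W.IsElliptic] [W.IsGloballyMinimal] (p : ℕ) [Fact p.Prime]
      (κ : ZpExtension ℚ p) (γ : Field.absoluteGaloisGroup ℚ) (N : ℕ) [NeZero N]
      (f : CuspForm (Gamma0 N) 2), kato_divisibility W p (κ := κ) (γ := γ) (f := f))
    (hS : Schneider1985_order_charGenerator_odd) (hMT : mazur_tate_sigma_exists_odd)
    (hmod : nonempty_modularParametrizationData)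
    (hGZK : rank_eq_analyticRank_of_analyticRank_le_one)
    (h3 : realPeriodRat_eq_unit_mul_plusPeriod_three)
    (a1 a2 a3 a4 a6 : ℤ) {W : WeierstrassCurve ℚ} [W.IsElliptic] [W.IsGloballyMinimal]
    (hW : integralModelInt W = ⟨a1, a2, a3, a4, a6⟩)
    [Fact (Nat.Prime 3)] (ℓ n n3 : ℕ) [Fact ℓ.Prime]
    (h3Δ : ¬ (3 : ℤ) ∣ discOf [a1, a2, a3, a4, a6])
    (hc3 : countPoints [a1, a2, a3, a4, a6] 3 = n3) (hord3 : ¬ (3 : ℤ) ∣ (3 : ℤ) + 1 - n3)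
    (hℓ2 : ℓ ≠ 2) (hℓ3 : ℓ ≠ 3) (hℓΔ : ¬ (ℓ : ℤ) ∣ discOf [a1, a2, a3, a4, a6])
    (hc : countPoints [a1, a2, a3, a4, a6] ℓ = n)
    (hnoroot : ∀ t : ℕ, t < 3 → ¬ (3 : ℤ) ∣ (t : ℤ) ^ 2 - ((ℓ : ℤ) + 1 - n) * t + ℓ)
    (hL : W.entireLFunction 1 ≠ 0)
    (hμ : ∀ (κ : ZpExtension ℚ 3) (γ : Field.absoluteGaloisGroup ℚ),
        κ.IsCyclotomic → κ.IsTopGenerator γ → IsCyclotomicVariable 3 γ →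
      ∀ (D : W.SelmerDualData κ γ), D.mu = 0) :
    Typed.MissingUpperBoundAt W 3 := by
  obtain ⟨hgood, hord, hirr⟩ := goodOrdIrr_three_of_ainvs_of_countPoints a1 a2 a3 a4 a6 hW ℓ n n3 h3Δ
    hc3 hord3 hℓ2 hℓ3 hℓΔ hc hnoroot
  exact missingUpperBoundAt_of_kato_of_greenbergMu W 3
    (greenberg_charValue_rankZero_of_Schneider1985_odd hS hMT) hmod hGZK
    (fun κ γ _ f ↦ hkato W 3 κ γ (W.conductorNorm ℤ) f) (by decide) hgood hord hirr hL
    (fun f hf ϖ hϖeq ↦ padicValRat_periodRatio_eq_zero_three W h3 hgood hirr f hf ϖ hϖeq) hμ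

/-- **Greenberg's `μ = 0` at `(E,3)` + `BSD(E,3)` ⟹ X_A3 at the pair, `MazurMainConjecture W 3`, for a
cell given by a literal integer model** (hypotheses as in
`missingUpperBoundAt_three_of_ainvs_of_greenbergMu`, minus `hmod`, plus `hbsd : BSDp W 3` — booked per
pair by the lane's certificates). One-line instance of `mainConjecture_of_bsdp_of_kato_of_greenbergMu`
(part 1). This is the `μ`-ZERO ROAD record shape: X_A3 AT THE PAIR modulo Greenberg's Conj. 1.11 at the
pair, for ANY rank-`0` N2 cell — anomalous, parity-odd and Ш-cells included (where no trivial road can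
exist, x10 GEN 27). Per pair; no class statement; nothing booked.
[cite: Kato2004Asterisque, Thm. 17.4 (2) (p. 273)] [cite: GreenbergLNM1716, §1 Conj. 1.11 and §5 (closing examples)]
[cite: Mazur1978, §6 Prop. 6.3 (1) (p. 153)] [cite: Miller2011LMS, Def. 1.1 (arXiv:1010.2431 p. 3)] -/
theorem mazurMainConjecture_three_of_ainvs_of_greenbergMu_of_bsdp
    (hkato : ∀ (W : WeierstrassCurve ℚ) [W.IsElliptic] [W.IsGloballyMinimal] (p : ℕ) [Fact p.Prime]
      (κ : ZpExtension ℚ p) (γ : Field.absoluteGaloisGroup ℚ) (N : ℕ) [NeZero N]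
      (f : CuspForm (Gamma0 N) 2), kato_divisibility W p (κ := κ) (γ := γ) (f := f))
    (hS : Schneider1985_order_charGenerator_odd) (hMT : mazur_tate_sigma_exists_odd)
    (hGZK : rank_eq_analyticRank_of_analyticRank_le_one)
    (h3 : realPeriodRat_eq_unit_mul_plusPeriod_three)
    (a1 a2 a3 a4 a6 : ℤ) {W : WeierstrassCurve ℚ} [W.IsElliptic] [W.IsGloballyMinimal]
    (hW : integralModelInt W = ⟨a1, a2, a3, a4, a6⟩)
    [Fact (Nat.Prime 3)] (ℓ n n3 : ℕ) [Fact ℓ.Prime]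
    (h3Δ : ¬ (3 : ℤ) ∣ discOf [a1, a2, a3, a4, a6])
    (hc3 : countPoints [a1, a2, a3, a4, a6] 3 = n3) (hord3 : ¬ (3 : ℤ) ∣ (3 : ℤ) + 1 - n3)
    (hℓ2 : ℓ ≠ 2) (hℓ3 : ℓ ≠ 3) (hℓΔ : ¬ (ℓ : ℤ) ∣ discOf [a1, a2, a3, a4, a6])
    (hc : countPoints [a1, a2, a3, a4, a6] ℓ = n)
    (hnoroot : ∀ t : ℕ, t < 3 → ¬ (3 : ℤ) ∣ (t : ℤ) ^ 2 - ((ℓ : ℤ) + 1 - n) * t + ℓ)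
    (hL : W.entireLFunction 1 ≠ 0)
    (hμ : ∀ (κ : ZpExtension ℚ 3) (γ : Field.absoluteGaloisGroup ℚ),
        κ.IsCyclotomic → κ.IsTopGenerator γ → IsCyclotomicVariable 3 γ →
      ∀ (D : W.SelmerDualData κ γ), D.mu = 0)
    (hbsd : BSDp W 3) : MazurMainConjecture W 3 := by
  obtain ⟨hgood, hord, hirr⟩ := goodOrdIrr_three_of_ainvs_of_countPoints a1 a2 a3 a4 a6 hW ℓ n n3 h3Δ
    hc3 hord3 hℓ2 hℓ3 hℓΔ hc hnoroot
  intro κ γ hκ hγ hγ' _ f hf ϖ hϖ D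
  exact mainConjecture_of_bsdp_of_kato_of_greenbergMu W 3
    (greenberg_charValue_rankZero_of_Schneider1985_odd hS hMT) hGZK
    (fun κ γ _ f ↦ hkato W 3 κ γ (W.conductorNorm ℤ) f) (by decide) hgood hord hirr hL
    (fun f hf ϖ hϖeq ↦ padicValRat_periodRatio_eq_zero_three W h3 hgood hirr f hf ϖ hϖeq) hμ hbsd
    κ γ hκ hγ hγ' f hf ϖ hϖ D

end MuZeroRoad


end Summit.BirchSwinnertonDyer.Rank1Residual.X10

end
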